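import Summits.ValiantsHypothesis.ValiantsHypothesis.Theorems.GrenetZeonAbelianizationQPCommutingProduct
import Summits.ValiantsHypothesis.ValiantsHypothesis.Theorems.GrenetZeonPolySizeQPAlgebraLongDiagonal
import HarnessLib

/-!
# Cruxes `GrenetZeon.AbelianizationQP` (8063) / `PolySizeQPAlgebra` (8064) — the mechanism meets the
# flattening bound: commuting affine products computing `per_n` have width `w² ≥ C(n,k)²/C(d,k)`

`GrenetZeonAbelianizationQPCommutingProduct.lean`: an entry of a product of `d` affine `w × w` pencils
with pairwise commuting coefficients is `λ(det diag(L_1..L_d))` over the commutative algebra the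
coefficients generate (`dim ≤ w²`).  `GrenetZeonPolySizeQPAlgebraLongDiagonal.lean`: such a diagonal
product equal to `per_n` forces `C(n,k)² ≤ C(d,k) · dim`.  Together:

* `exists_diagonal_data_of_commute` — the mechanism with its diagonal data exported (not only
  `HasAlgDetRepr`): `R`, `λ`, affine `L_k ∈ R[x]` with `λ(coeff (∏ L_k)) = coeff (entry)`.
* `width_bound_of_commuting_product` — if `per_n` is an entry of a product of `d` affine pencils of
  width `w` over `ℂ` with pairwise commuting coefficient matrices, then `C(n,k)² ≤ C(d,k) · w²` for
  every `k ≤ d`.  Reading for 8063: the commuting re-expression route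
  (`abelianizationQP_of_commutingReexpression`) needs `d · k ≳ n²`, i.e. length exponent `c ≥ 2`
  (for `d ≤ n^{2−ε}` the width is superpolynomial whatever the size `m` of the given representation);
  Grenet's program (`d = n`, `w = 2^n`) is consistent (`C(n,k) ≤ 4^n`).

Honest framing: a constraint on ONE positive mechanism, not on the crux; nothing here is progress on
VP ≠ VNP.  Axioms standard.
-/

set_option linter.dupNamespace false

noncomputable section

namespace Summit.ValiantsHypothesis.ValiantsHypothesis.Theorems.GrenetZeonAbelianizationQP

open MvPolynomial Matrix
open Literature.Computability.AlgebraicComplexity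
open Summit.ValiantsHypothesis.ValiantsHypothesis.Theorems.GrenetZeonPolySizeQPAlgebra

variable {K : Type} [Field K] {ι : Type} {β : Type} [Fintype β] [DecidableEq β]

/-- **The mechanism with explicit diagonal data.** For affine pencils with pairwise commuting
coefficient matrices, the entry `(a, b)` of their product is `λ` applied coefficientwise to the
PRODUCT `∏_k L_k` of affine forms over the commutative algebra `R` generated by the coefficients
(`dim R ≤ w²`), `λ(r) = r_{ab}`. (Same construction as `hasAlgDetRepr_entry_prod_of_commute`, with the
data exported.) [cite: HrubesYehudayoff2011, §4] -/
theorem exists_diagonal_data_of_commute [Fintype ι] [DecidableEq ι] {d : ℕ}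
    (B₀ : Fin d → Matrix β β K) (B : Fin d → ι → Matrix β β K)
    (hcomm : ∀ x ∈ Set.range B₀ ∪ Set.range (Function.uncurry B),
      ∀ y ∈ Set.range B₀ ∪ Set.range (Function.uncurry B), x * y = y * x)
    (a b : β) :
    ∃ (R : Type) (_ : CommRing R) (_ : Algebra K R) (_ : Module.Finite K R),
      Module.finrank K R ≤ Fintype.card β ^ 2 ∧
        ∃ (l : R →ₗ[K] K) (L : Fin d → MvPolynomial ι R), (∀ k, (L k).totalDegree ≤ 1) ∧
          ∀ e : ι →₀ ℕ, l (coeff e (∏ k, L k)) =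
            coeff e (((List.ofFn fun k : Fin d => Matrix.of fun i j =>
              (C (B₀ k i j) + ∑ t, C (B k t i j) * X t : MvPolynomial ι K)).prod) a b) := by
  classical
  set S : Set (Matrix β β K) := Set.range B₀ ∪ Set.range (Function.uncurry B) with hS
  haveI hc : IsMulCommutative (Algebra.adjoin K S) := Algebra.isMulCommutative_adjoin K hcomm
  letI : CommRing (Algebra.adjoin K S) :=
    { (inferInstance : Ring (Algebra.adjoin K S)) with mul_comm := mul_comm' }
  have hB₀ : ∀ k, B₀ k ∈ Algebra.adjoin K S := fun k =>
    Algebra.subset_adjoin (Or.inl ⟨k, rfl⟩)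
  have hB : ∀ k t, B k t ∈ Algebra.adjoin K S := fun k t =>
    Algebra.subset_adjoin (Or.inr ⟨(k, t), rfl⟩)
  set L : Fin d → MvPolynomial ι (Algebra.adjoin K S) := fun k =>
    C ⟨B₀ k, hB₀ k⟩ + ∑ t, C ⟨B k t, hB k t⟩ * X t with hLdef
  have hL : ∀ k, (L k).totalDegree ≤ 1 := by
    intro k
    refine (totalDegree_add _ _).trans (max_le ?_ ?_)
    · rw [totalDegree_C]; exact Nat.zero_le _
    · refine (totalDegree_finsetSum _ _).trans (Finset.sup_le fun t _ => ?_)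
      refine (totalDegree_mul _ _).trans ?_
      rw [totalDegree_C, zero_add]
      rcases subsingleton_or_nontrivial (Algebra.adjoin K S) with h0 | h1
      · rw [Subsingleton.elim (X t : MvPolynomial ι (Algebra.adjoin K S)) 0, totalDegree_zero]
        exact Nat.zero_le _
      · rw [totalDegree_X]
  set ρ : Algebra.adjoin K S →ₐ[K] Matrix β β K := (Algebra.adjoin K S).val with hρ
  -- identify the matrices of coefficientwise entries with the given pencils
  have hmat : (fun k : Fin d => Matrix.of fun i j => (AddMonoidAlgebra.map
      ((Matrix.entryAddMonoidHom K i j).comp (ρ : Algebra.adjoin K S →+* Matrix β β K).toAddMonoidHom)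
      (L k) : MvPolynomial ι K)) =
      fun k : Fin d => Matrix.of fun i j =>
        (C (B₀ k i j) + ∑ t, C (B k t i j) * X t : MvPolynomial ι K) := by
    funext k
    refine Matrix.ext fun i j => MvPolynomial.ext _ _ fun e => ?_
    rw [Matrix.of_apply, Matrix.of_apply]
    show (Matrix.entryAddMonoidHom K i j)
        ((ρ : Algebra.adjoin K S →+* Matrix β β K) (coeff e (L k))) =
      coeff e (C (B₀ k i j) + ∑ t, C (B k t i j) * X t)
    simp only [hLdef, hρ, coeff_add, coeff_sum, coeff_C_mul, coeff_X, coeff_C, mul_ite, mul_one,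
      mul_zero, map_add, map_sum, Matrix.entryAddMonoidHom_apply]
    congr 1
    · split_ifs <;> simp
    · refine Finset.sum_congr rfl fun t _ => ?_
      split_ifs <;> simp
  refine ⟨Algebra.adjoin K S, inferInstance, inferInstance, inferInstance,
    finrank_adjoin_matrix_le S,
    (Matrix.entryLinearMap K K a b).comp ρ.toLinearMap, L, hL, fun e => ?_⟩
  have h := congrFun (congrFun (of_mapEntry_list_prod ρ (List.ofFn L)) a) b
  rw [List.map_ofFn, Matrix.of_apply, List.prod_ofFn] at h
  have hcoeff := congrArg (MvPolynomial.coeff e) h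
  simp only [Function.comp_def] at hcoeff
  rw [hmat] at hcoeff
  rw [← hcoeff]
  rfl

/-- **Width bound for commuting affine products computing the permanent.** If `per_n` is the
`(a, b)` entry of a product of `d` affine `w × w` pencils over `ℂ` whose coefficient matrices
pairwise commute, then `C(n,k)² ≤ C(d,k) · w²` for every `k ≤ d` (`exists_diagonal_data_of_commute` +
`longDiagonalBound`).  So the commuting re-expression route to `AbelianizationQP` needs length
`d` with `d · k ≳ n²` (exponent `c ≥ 2`). [cite: NisanWigderson1996, §2] -/
theorem width_bound_of_commuting_product {n d k : ℕ} (hkd : k ≤ d) {β : Type} [Fintype β]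
    [DecidableEq β] (B₀ : Fin d → Matrix β β ℂ) (B : Fin d → Fin n × Fin n → Matrix β β ℂ)
    (hcomm : ∀ x ∈ Set.range B₀ ∪ Set.range (Function.uncurry B),
      ∀ y ∈ Set.range B₀ ∪ Set.range (Function.uncurry B), x * y = y * x)
    (a b : β)
    (hper : perPoly (Fin n) ℂ =
      ((List.ofFn fun k : Fin d => Matrix.of fun i j =>
        (C (B₀ k i j) + ∑ t, C (B k t i j) * X t : MvPolynomial (Fin n × Fin n) ℂ)).prod) a b) :
    (n.choose k) ^ 2 ≤ d.choose k * Fintype.card β ^ 2 := by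
  classical
  obtain ⟨R, _, _, _, hR, l, L, hL, hcoeff⟩ := exists_diagonal_data_of_commute B₀ B hcomm a b
  have hcoeff' : ∀ e : (Fin n × Fin n) →₀ ℕ,
      l (coeff e (∏ k, L k)) = coeff e (perPoly (Fin n) ℂ) := fun e => by
    rw [hcoeff e, ← hper]
  exact (longDiagonalBound hkd l L hL hcoeff').trans (Nat.mul_le_mul_left _ hR)

end Summit.ValiantsHypothesis.ValiantsHypothesis.Theorems.GrenetZeonAbelianizationQP

end
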